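import Summits.AtomisticToContinuum.HydrodynamicLimit.Theses.OneFlightGossipEngine
import Summits.AtomisticToContinuum.HydrodynamicLimit.Theorems.BoltzmannGreenKubo.Negative.PiStatics
import Literature.MathematicalPhysics.KineticTheory.HardSphereEulerProofs
import Mathlib.Probability.Distributions.Gaussian.Fernique

/-!
# Statics of the fast kinetic heat flux under the centred canonical Gibbs law (support file 1 for C4)

Support lemmas for the route item `EquilibriumHeatFluxVarianceDecay` (stmt-AtomisticToContinuum-9532, route
OneFlightGossipEngine): the one-particle observable `h_θ(v) = v⁰‖v‖² − 5θ v⁰` (the FAST part of the kinetic energy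
current: `v⁰‖v‖²` minus its `L²(M_{0,θ})`-projection `5θ v⁰` onto the collision invariant `v⁰`) is odd, has Gaussian
moments of every order (Fernique), and for the per-particle empirical heat flux
`Y(z) = (N+1)⁻¹ Σᵢ φ(xᵢ) h_θ(vᵢ)` the EQUAL-TIME second moment under the canonical law
`λ^N = localGibbsLaw σ a₀ 0 θ₀ N Φ` (velocities i.i.d. `N(0, θ₀)` given the positions, oddness kills the cross terms)
obeys `E_λ[Y²] ≤ (N+1)⁻¹ K² m₂(θ₀)` with `|φ| ≤ K` and `m₂(θ) = ∫ h_θ² dN(0,θ)` (`lintegral_Yobs_sq_le`).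
These are the static inputs of the a-priori bound `(N+1)·E_λ[Ȳ_τ²] ≤ K² m₂(θ₀)` (file `…Apriori`), which shows that
the `(N+1)`-normalisation of the item is critical (its `limsup_N` is finite for every window).
prover-pitem-stmt-AtomisticToContinuum-9532-0.
-/

noncomputable section

namespace Summit.AtomisticToContinuum.HydrodynamicLimit.Theorems

open MeasureTheory ProbabilityTheory Filter Topology Set
open Literature.Analysis.FluidPDE Literature.MathematicalPhysics.KineticTheory
open scoped InnerProductSpace ENNReal
open BoltzmannGreenKuboOrthMomentum

namespace OneFlightGossipEngineHeatFlux

/-! ## The one-particle fast heat flux `h_θ` -/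

/-- Notation (no new constant): the fast kinetic heat flux of one particle, `𝐡[θ, v] = v⁰‖v‖² − 5θ v⁰` — the first
component of `v|v|²` minus its `L²(M_{0,θ})`-projection `5θ v⁰` onto the collision invariant `v⁰`, literally the
integrand of the item. -/
scoped notation "𝐡[" θ ", " v "]" => (v 0 * ‖v‖ ^ 2 - 5 * θ * v 0)

/-- Notation (no new constant): the second Gaussian moment `𝐦₂[θ] = ∫ 𝐡[θ, v]² N(0,θ)(dv)` (`= 10 θ³`; only its
finiteness is used). -/
scoped notation "𝐦₂[" θ "]" => (∫ v, (v 0 * ‖v‖ ^ 2 - 5 * θ * v 0) ^ 2 ∂gaussMeasure (0 : V3) θ)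

/-- Notation (no new constant): the per-particle empirical fast heat flux of `N + 1` particles tested against `φ`,
`𝐘[N, θ, φ, z] = (N+1)⁻¹ Σᵢ φ(xᵢ) 𝐡[θ, vᵢ]`, literally the item's summand structure. -/
scoped notation "𝐘[" N ", " θ ", " φ ", " z "]" =>
  (((N : ℝ) + 1)⁻¹ * ∑ i : Fin (N + 1),
    φ (Prod.fst (z i)) * (Prod.snd (z i) 0 * ‖Prod.snd (z i)‖ ^ 2 - 5 * θ * Prod.snd (z i) 0))

/-- `h_θ` is odd. [folklore] -/
theorem hf_neg (θ : ℝ) (v : V3) : 𝐡[θ, -v] = -𝐡[θ, v] := by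
  have : (-v) 0 = -(v 0) := rfl
  simp only [this, norm_neg]
  ring

/-- The first coordinate is continuous on `ℝ³`. [folklore] -/
theorem continuous_coord0 : Continuous fun v : V3 => v 0 :=
  (EuclideanSpace.proj (𝕜 := ℝ) (0 : Fin 3)).continuous

/-- `h_θ` is continuous. [folklore] -/
theorem continuous_hf (θ : ℝ) : Continuous fun v : V3 => 𝐡[θ, v] :=
  (continuous_coord0.mul (continuous_norm.pow 2)).sub (continuous_const.mul continuous_coord0)

/-- `h_θ` is measurable. [folklore] -/
theorem measurable_hf (θ : ℝ) : Measurable fun v : V3 => 𝐡[θ, v] := (continuous_hf θ).measurable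

/-- `|v⁰| ≤ ‖v‖`. [folklore] -/
theorem abs_coord0_le (v : V3) : |v 0| ≤ ‖v‖ := by
  have h := PiLp.norm_apply_le v 0
  rwa [Real.norm_eq_abs] at h

/-- Polynomial bound `|h_θ(v)| ≤ ‖v‖³ + 5|θ|‖v‖`. [folklore] -/
theorem abs_hf_le (θ : ℝ) (v : V3) : |𝐡[θ, v]| ≤ ‖v‖ ^ 3 + 5 * |θ| * ‖v‖ := by
  have h0 := abs_coord0_le v
  have hn := norm_nonneg v
  calc |v 0 * ‖v‖ ^ 2 - 5 * θ * v 0| ≤ |v 0 * ‖v‖ ^ 2| + |5 * θ * v 0| := abs_sub _ _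
    _ = |v 0| * ‖v‖ ^ 2 + 5 * |θ| * |v 0| := by
        rw [abs_mul, abs_mul, abs_mul, abs_of_nonneg (by positivity : (0 : ℝ) ≤ ‖v‖ ^ 2)]
        norm_num
    _ ≤ ‖v‖ * ‖v‖ ^ 2 + 5 * |θ| * ‖v‖ := by gcongr
    _ = ‖v‖ ^ 3 + 5 * |θ| * ‖v‖ := by ring

/-- Squared polynomial bound `h_θ(v)² ≤ 2‖v‖⁶ + 50 θ² ‖v‖²`. [folklore] -/
theorem hf_sq_le (θ : ℝ) (v : V3) : 𝐡[θ, v] ^ 2 ≤ 2 * ‖v‖ ^ 6 + 50 * θ ^ 2 * ‖v‖ ^ 2 := by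
  have h := abs_hf_le θ v
  have hn := norm_nonneg v
  have hsq : 𝐡[θ, v] ^ 2 ≤ (‖v‖ ^ 3 + 5 * |θ| * ‖v‖) ^ 2 := by
    rw [← sq_abs (𝐡[θ, v])]
    exact pow_le_pow_left₀ (abs_nonneg _) h 2
  have hθ : |θ| ^ 2 = θ ^ 2 := sq_abs θ
  nlinarith [sq_nonneg (‖v‖ ^ 3 - 5 * |θ| * ‖v‖), hsq, hθ]

/-! ## Gaussian moments of `h_θ` -/

/-- All norm moments of the isotropic Gaussian `N(0, θ)` on `ℝ³` are finite (Fernique). [folklore] -/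
theorem integrable_norm_pow_gaussMeasure (θ : ℝ) (n : ℕ) :
    Integrable (fun v : V3 => ‖v‖ ^ n) (gaussMeasure (0 : V3) θ) := by
  have h := (IsGaussian.memLp_id (gaussMeasure (0 : V3) θ) n (ENNReal.natCast_ne_top n)).integrable_norm_pow'
  simpa using h

/-- `h_θ²` is `N(0,θ)`-integrable. [folklore] -/
theorem integrable_hf_sq (θ : ℝ) : Integrable (fun v : V3 => 𝐡[θ, v] ^ 2) (gaussMeasure (0 : V3) θ) := by
  have hdom : Integrable (fun v : V3 => 2 * ‖v‖ ^ 6 + 50 * θ ^ 2 * ‖v‖ ^ 2) (gaussMeasure (0 : V3) θ) :=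
    ((integrable_norm_pow_gaussMeasure θ 6).const_mul 2).add
      ((integrable_norm_pow_gaussMeasure θ 2).const_mul (50 * θ ^ 2))
  refine hdom.mono' (((measurable_hf θ).pow_const 2).aestronglyMeasurable) (Eventually.of_forall fun v => ?_)
  rw [Real.norm_eq_abs, abs_of_nonneg (sq_nonneg _)]
  exact hf_sq_le θ v

/-- `h_θ` is `N(0,θ)`-integrable. [folklore] -/
theorem integrable_hf (θ : ℝ) : Integrable (fun v : V3 => 𝐡[θ, v]) (gaussMeasure (0 : V3) θ) := by
  have hdom : Integrable (fun v : V3 => ‖v‖ ^ 3 + 5 * |θ| * ‖v‖) (gaussMeasure (0 : V3) θ) := by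
    have h1 := integrable_norm_pow_gaussMeasure θ 1
    simp only [pow_one] at h1
    exact (integrable_norm_pow_gaussMeasure θ 3).add (h1.const_mul (5 * |θ|))
  refine hdom.mono' (measurable_hf θ).aestronglyMeasurable (Eventually.of_forall fun v => ?_)
  rw [Real.norm_eq_abs]
  exact abs_hf_le θ v

/-- `m₂(θ) ≥ 0`. [folklore] -/
theorem m2_nonneg (θ : ℝ) : 0 ≤ 𝐦₂[θ] := integral_nonneg fun _ => sq_nonneg _

/-- `N(0, θ)` on `ℝ³` is invariant under `v ↦ −v`. [folklore] -/
theorem measurePreserving_neg_gaussMeasure (θ : ℝ) :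
    MeasurePreserving (fun v : V3 => -v) (gaussMeasure (0 : V3) θ) (gaussMeasure (0 : V3) θ) := by
  have hT : Measurable fun w : V3 => (0 : V3) + Real.sqrt θ • w := measurable_gaussShift 0 θ
  refine ⟨measurable_neg, ?_⟩
  rw [gaussMeasure, Measure.map_map measurable_neg hT]
  have hcomm : (fun v : V3 => -v) ∘ (fun w : V3 => (0 : V3) + Real.sqrt θ • w) =
      (fun w : V3 => (0 : V3) + Real.sqrt θ • w) ∘ fun v : V3 => -v := by
    funext w
    simp
  rw [hcomm, ← Measure.map_map hT measurable_neg, measurePreserving_neg_stdGaussian.map_eq]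

/-! ## Products: odd weighted sums on product Gaussians -/

variable {n : ℕ}

/-- Products `h_θ(vᵢ) h_θ(vⱼ)` are integrable on the product Gaussian (AM–GM domination). [folklore] -/
theorem integrable_pi_hf_hf (θ : ℝ) (i j : Fin n) :
    Integrable (fun v : Fin n → V3 => 𝐡[θ, v i] * 𝐡[θ, v j]) (Measure.pi fun _ : Fin n => gaussMeasure (0 : V3) θ) := by
  have hsq : ∀ k : Fin n, Integrable (fun v : Fin n → V3 => 𝐡[θ, v k] ^ 2)
      (Measure.pi fun _ : Fin n => gaussMeasure (0 : V3) θ) := fun k =>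
    ((measurePreserving_eval (fun _ : Fin n => gaussMeasure (0 : V3) θ) k).integrable_comp
      (integrable_hf_sq θ).aestronglyMeasurable).2 (integrable_hf_sq θ)
  have hdom : Integrable (fun v : Fin n → V3 => (𝐡[θ, v i] ^ 2 + 𝐡[θ, v j] ^ 2) / 2)
      (Measure.pi fun _ : Fin n => gaussMeasure (0 : V3) θ) := ((hsq i).add (hsq j)).div_const 2
  refine hdom.mono'
    (((measurable_hf θ).comp (measurable_pi_apply i)).mul ((measurable_hf θ).comp (measurable_pi_apply j))).aestronglyMeasurable
    (Eventually.of_forall fun v => ?_)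
  rw [Real.norm_eq_abs, abs_mul]
  nlinarith [sq_nonneg (|𝐡[θ, v i]| - |𝐡[θ, v j]|), sq_abs (𝐡[θ, v i]), sq_abs (𝐡[θ, v j]),
    abs_nonneg (𝐡[θ, v i]), abs_nonneg (𝐡[θ, v j])]

/-- **Weighted odd sums on a product law**: for `a` odd and `μ` reflection-invariant,
`∫ (Σᵢ cᵢ a(vᵢ))² d(⊗ⁿμ) = (Σᵢ cᵢ²) ∫ a² dμ` (cross terms vanish by flipping one particle). [folklore] -/
theorem integral_sq_weightedSum (μ : Measure V3) [IsProbabilityMeasure μ]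
    (hμ : MeasurePreserving (fun v : V3 => -v) μ μ) (a : V3 → ℝ) (ha : ∀ v, a (-v) = -a v)
    (hameas : Measurable a)
    (hab : ∀ i j : Fin n, Integrable (fun v : Fin n → V3 => a (v i) * a (v j)) (Measure.pi fun _ : Fin n => μ))
    (c : Fin n → ℝ) :
    ∫ v, (∑ i, c i * a (v i)) ^ 2 ∂(Measure.pi fun _ : Fin n => μ) = (∑ i, c i ^ 2) * ∫ w, a w ^ 2 ∂μ := by
  have hexp : (fun v : Fin n → V3 => (∑ i, c i * a (v i)) ^ 2) =
      fun v => ∑ i, ∑ j, (c i * c j) * (a (v i) * a (v j)) := by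
    funext v
    rw [sq, Finset.sum_mul_sum]
    refine Finset.sum_congr rfl fun i _ => Finset.sum_congr rfl fun j _ => ?_
    ring
  rw [hexp, integral_finsetSum _ (fun i _ => integrable_finsetSum _ (fun j _ => (hab i j).const_mul _))]
  have hi : ∀ i : Fin n, ∫ v, ∑ j, (c i * c j) * (a (v i) * a (v j)) ∂(Measure.pi fun _ : Fin n => μ) =
      c i ^ 2 * ∫ w, a w ^ 2 ∂μ := by
    intro i
    rw [integral_finsetSum _ (fun j _ => (hab i j).const_mul _)]
    rw [Finset.sum_eq_single i (fun j _ hji => by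
        rw [integral_const_mul, integral_cross_eq_zero μ hμ a a ha (Ne.symm hji), mul_zero])
      (fun h => (h (Finset.mem_univ i)).elim)]
    rw [integral_const_mul, integral_diag μ (fun w => a w * a w) (hameas.mul hameas) i]
    simp_rw [sq]
  simp only [hi, ← Finset.sum_mul]

/-! ## The per-particle empirical fast heat flux and its static second moment -/

variable {N : ℕ}

/-- `Y` is measurable for continuous `φ`. [folklore] -/
theorem measurable_Yobs (θ : ℝ) {φ : T3 → ℝ} (hφ : Continuous φ) :
    Measurable fun z : Config (N + 1) (Fin 3) T3 => 𝐘[N, θ, φ, z] := by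
  refine measurable_const.mul (Finset.measurable_sum _ fun i _ => ?_)
  exact (hφ.measurable.comp (measurable_pi_apply i).fst).mul ((measurable_hf θ).comp (measurable_pi_apply i).snd)

/-- `Y` on a zipped configuration: `Y(x, v) = (N+1)⁻¹ Σᵢ φ(xᵢ) h_θ(vᵢ)`. [folklore] -/
theorem Yobs_zipConfig (θ : ℝ) (φ : T3 → ℝ) (x : Fin (N + 1) → T3) (v : Fin (N + 1) → V3) :
    𝐘[N, θ, φ, zipConfig (x, v)] = ((N : ℝ) + 1)⁻¹ * ∑ i, φ (x i) * 𝐡[θ, v i] := by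
  simp

/-- The velocity law given the positions, for the centred constant profiles, is the product `⊗ N(0, θ₀)`. [folklore] -/
theorem velMeasure_const (θ₀ : ℝ) (x : Fin (N + 1) → T3) :
    velMeasure (fun _ : T3 => (0 : V3)) (fun _ : T3 => θ₀) x = Measure.pi fun _ : Fin (N + 1) => gaussMeasure (0 : V3) θ₀ :=
  rfl

/-- **Static second moment given the positions**: `∫ Y(x,v)² ⊗N(0,θ₀)(dv) = (N+1)⁻² (Σᵢ φ(xᵢ)²) m₂(θ₀)`. [folklore] -/
theorem integral_Yobs_zipConfig_sq (θ₀ : ℝ) (φ : T3 → ℝ) (x : Fin (N + 1) → T3) :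
    ∫ v, 𝐘[N, θ₀, φ, zipConfig (x, v)] ^ 2 ∂(Measure.pi fun _ : Fin (N + 1) => gaussMeasure (0 : V3) θ₀) =
      (((N : ℝ) + 1)⁻¹) ^ 2 * ((∑ i, φ (x i) ^ 2) * 𝐦₂[θ₀]) := by
  simp only [Yobs_zipConfig, mul_pow]
  rw [integral_const_mul, integral_sq_weightedSum (gaussMeasure (0 : V3) θ₀) (measurePreserving_neg_gaussMeasure θ₀)
    (fun v => 𝐡[θ₀, v]) (hf_neg θ₀) (measurable_hf θ₀) (integrable_pi_hf_hf θ₀) (fun i => φ (x i))]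

/-- Integrability of `v ↦ Y(x,v)²` on the product Gaussian. [folklore] -/
theorem integrable_Yobs_zipConfig_sq (θ₀ : ℝ) (φ : T3 → ℝ) (x : Fin (N + 1) → T3) :
    Integrable (fun v => 𝐘[N, θ₀, φ, zipConfig (x, v)] ^ 2) (Measure.pi fun _ : Fin (N + 1) => gaussMeasure (0 : V3) θ₀) := by
  have hexp : (fun v : Fin (N + 1) → V3 => 𝐘[N, θ₀, φ, zipConfig (x, v)] ^ 2) =
      fun v => (((N : ℝ) + 1)⁻¹) ^ 2 * ∑ i, ∑ j, (φ (x i) * φ (x j)) * (𝐡[θ₀, v i] * 𝐡[θ₀, v j]) := by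
    funext v
    rw [Yobs_zipConfig, mul_pow, sq (∑ i, φ (x i) * 𝐡[θ₀, v i]), Finset.sum_mul_sum]
    congr 1
    refine Finset.sum_congr rfl fun i _ => Finset.sum_congr rfl fun j _ => ?_
    ring
  rw [hexp]
  exact (integrable_finsetSum _ fun i _ => integrable_finsetSum _ fun j _ =>
    (integrable_pi_hf_hf θ₀ i j).const_mul _).const_mul _

/-- Pointwise bound `Σᵢ φ(xᵢ)² ≤ (N+1) K²` for `|φ| ≤ K`. [folklore] -/
theorem sum_sq_le {φ : T3 → ℝ} {K : ℝ} (hφK : ∀ y, |φ y| ≤ K) (x : Fin (N + 1) → T3) :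
    ∑ i, φ (x i) ^ 2 ≤ ((N : ℝ) + 1) * K ^ 2 := by
  calc ∑ i, φ (x i) ^ 2 ≤ ∑ _i : Fin (N + 1), K ^ 2 := Finset.sum_le_sum fun i _ => by
          rw [← sq_abs (φ (x i))]
          exact pow_le_pow_left₀ (abs_nonneg _) (hφK _) 2
    _ = ((N : ℝ) + 1) * K ^ 2 := by
        simp [Finset.sum_const, Finset.card_univ, Fintype.card_fin]

/-- **STATIC BOUND.** Under the centred canonical Gibbs law (`σ ≤ 1/2`, constant profiles `a₀, θ₀ > 0`,
`u₀ = 0`) the equal-time second moment of the per-particle fast heat flux satisfies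
`E_λ[Y²] ≤ (N+1)⁻¹ K² m₂(θ₀)` for `|φ| ≤ K`: velocities are i.i.d. `N(0,θ₀)` given the positions and the cross
terms vanish by oddness of `h_θ`. [folklore] -/
theorem lintegral_Yobs_sq_le {a₀ θ₀ σ : ℝ} (ha : 0 < a₀) (hθ : 0 < θ₀) (hσ : σ ≤ 1 / 2) (N : ℕ)
    (Φ : HardSphereFlow (Torus.geometry (Fin 3)) (hsDiameter σ N) (N + 1))
    {φ : T3 → ℝ} (hφ : Continuous φ) {K : ℝ} (hφK : ∀ y, |φ y| ≤ K) :
    ∫⁻ z, ENNReal.ofReal (𝐘[N, θ₀, φ, z] ^ 2) ∂(localGibbsLaw σ (fun _ => a₀) (fun _ => 0) (fun _ => θ₀) N Φ) ≤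
      ENNReal.ofReal (((N : ℝ) + 1)⁻¹ * (K ^ 2 * 𝐦₂[θ₀])) := by
  haveI : IsProbabilityMeasure (localGibbsMeasure σ (fun _ => a₀) (fun _ => (0 : V3)) (fun _ => θ₀) N) :=
    isProbabilityMeasure_localGibbsMeasure continuous_const continuous_const continuous_const
      (fun _ => ha) (fun _ => hθ) hσ N
  have hG : Measurable fun z : Config (N + 1) (Fin 3) T3 => ENNReal.ofReal (𝐘[N, θ₀, φ, z] ^ 2) :=
    ((measurable_Yobs θ₀ hφ).pow_const 2).ennreal_ofReal
  rw [localGibbsLaw_eq, lintegral_localGibbsMeasure continuous_const continuous_const continuous_const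
    (fun _ => ha.le) (fun _ => hθ) σ N hG]
  have hin : ∀ x : Fin (N + 1) → T3,
      ∫⁻ v, ENNReal.ofReal (𝐘[N, θ₀, φ, zipConfig (x, v)] ^ 2) ∂velMeasure (fun _ : T3 => (0 : V3)) (fun _ : T3 => θ₀) x ≤
        ENNReal.ofReal (((N : ℝ) + 1)⁻¹ * (K ^ 2 * 𝐦₂[θ₀])) := by
    intro x
    rw [velMeasure_const, ← ofReal_integral_eq_lintegral_ofReal (integrable_Yobs_zipConfig_sq θ₀ φ x)
      (Eventually.of_forall fun v => sq_nonneg _), integral_Yobs_zipConfig_sq]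
    refine ENNReal.ofReal_le_ofReal ?_
    have hN : (0 : ℝ) < (N : ℝ) + 1 := by positivity
    have hm := m2_nonneg θ₀
    calc (((N : ℝ) + 1)⁻¹) ^ 2 * ((∑ i, φ (x i) ^ 2) * 𝐦₂[θ₀])
        ≤ (((N : ℝ) + 1)⁻¹) ^ 2 * ((((N : ℝ) + 1) * K ^ 2) * 𝐦₂[θ₀]) := by
          gcongr
          exact sum_sq_le hφK x
      _ = ((N : ℝ) + 1)⁻¹ * (K ^ 2 * 𝐦₂[θ₀]) := by
          field_simp
  calc ∫⁻ x, ENNReal.ofReal ((canonicalPartition (Torus.geometry (Fin 3)) (hsDiameter σ N) (N + 1)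
          (localGibbsProfile (fun _ => a₀) (fun _ => 0) (fun _ => θ₀)))⁻¹ * posWeight (fun _ => a₀) (hsDiameter σ N) (N + 1) x) *
        ∫⁻ v, ENNReal.ofReal (𝐘[N, θ₀, φ, zipConfig (x, v)] ^ 2) ∂velMeasure (fun _ : T3 => (0 : V3)) (fun _ : T3 => θ₀) x
      ≤ ∫⁻ x, ENNReal.ofReal ((canonicalPartition (Torus.geometry (Fin 3)) (hsDiameter σ N) (N + 1)
          (localGibbsProfile (fun _ => a₀) (fun _ => 0) (fun _ => θ₀)))⁻¹ * posWeight (fun _ => a₀) (hsDiameter σ N) (N + 1) x) *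
        ENNReal.ofReal (((N : ℝ) + 1)⁻¹ * (K ^ 2 * 𝐦₂[θ₀])) := lintegral_mono fun x => mul_le_mul_right (hin x) _
    _ = ENNReal.ofReal (((N : ℝ) + 1)⁻¹ * (K ^ 2 * 𝐦₂[θ₀])) := by
        rw [lintegral_mul_const' _ _ ENNReal.ofReal_ne_top,
          lintegral_posWeight_eq_one continuous_const continuous_const continuous_const (fun _ => ha.le)
            (fun _ => hθ) σ N, one_mul]

/-- The one-particle marginal: `∫ h_θ₀(vᵢ)² dλ = m₂(θ₀)` (as a lower Lebesgue integral). [folklore] -/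
theorem lintegral_hf_sq_eq {a₀ θ₀ σ : ℝ} (ha : 0 < a₀) (hθ : 0 < θ₀) (hσ : σ ≤ 1 / 2) (N : ℕ)
    (Φ : HardSphereFlow (Torus.geometry (Fin 3)) (hsDiameter σ N) (N + 1)) (i : Fin (N + 1)) :
    ∫⁻ z, ENNReal.ofReal (𝐡[θ₀, (z i).2] ^ 2) ∂(localGibbsLaw σ (fun _ => a₀) (fun _ => 0) (fun _ => θ₀) N Φ) =
      ENNReal.ofReal (𝐦₂[θ₀]) := by
  haveI : IsProbabilityMeasure (localGibbsMeasure σ (fun _ => a₀) (fun _ => (0 : V3)) (fun _ => θ₀) N) :=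
    isProbabilityMeasure_localGibbsMeasure continuous_const continuous_const continuous_const
      (fun _ => ha) (fun _ => hθ) hσ N
  have hG : Measurable fun z : Config (N + 1) (Fin 3) T3 => ENNReal.ofReal (𝐡[θ₀, (z i).2] ^ 2) :=
    (((measurable_hf θ₀).comp (measurable_pi_apply i).snd).pow_const 2).ennreal_ofReal
  rw [localGibbsLaw_eq, lintegral_localGibbsMeasure continuous_const continuous_const continuous_const
    (fun _ => ha.le) (fun _ => hθ) σ N hG]
  have hsq : Integrable (fun v : Fin (N + 1) → V3 => 𝐡[θ₀, v i] ^ 2)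
      (Measure.pi fun _ : Fin (N + 1) => gaussMeasure (0 : V3) θ₀) :=
    ((measurePreserving_eval (fun _ : Fin (N + 1) => gaussMeasure (0 : V3) θ₀) i).integrable_comp
      (integrable_hf_sq θ₀).aestronglyMeasurable).2 (integrable_hf_sq θ₀)
  have hin : ∀ x : Fin (N + 1) → T3,
      ∫⁻ v, ENNReal.ofReal (𝐡[θ₀, ((zipConfig (x, v)) i).2] ^ 2) ∂velMeasure (fun _ : T3 => (0 : V3)) (fun _ : T3 => θ₀) x =
        ENNReal.ofReal (𝐦₂[θ₀]) := by
    intro x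
    simp only [zipConfig_apply]
    rw [velMeasure_const, ← ofReal_integral_eq_lintegral_ofReal hsq (Eventually.of_forall fun v => sq_nonneg _),
      integral_diag (gaussMeasure (0 : V3) θ₀) (fun w => 𝐡[θ₀, w] ^ 2) ((measurable_hf θ₀).pow_const 2) i]
  simp only [hin]
  rw [lintegral_mul_const' _ _ ENNReal.ofReal_ne_top,
    lintegral_posWeight_eq_one continuous_const continuous_const continuous_const (fun _ => ha.le)
      (fun _ => hθ) σ N, one_mul]

end OneFlightGossipEngineHeatFlux

end Summit.AtomisticToContinuum.HydrodynamicLimit.Theorems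

end
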